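import Mathlib.Analysis.Distribution.SchwartzSpace.Fourier
import Mathlib.Analysis.Calculus.BumpFunction.InnerProduct
import HarnessLib

/-!
# Spectral filter functions (Hastings / Bachmann–Michalakis–Nachtergaele–Sims)

Fifth file of the formalisation of the Michalakis–Zwolak stability theorem (hubbard.S19): the
**existence of a filter function** `w ∈ 𝓢(ℝ)` with `∫ w = 1` whose Fourier transform is
compactly supported in the gap, i.e. `∫ w(t) e^{itΔ} dt = 0` for `|Δ| ≥ γ`. In MZ13 (Michalakis–
Zwolak, CMP **322** (2013) 277 = arXiv:1109.1588), §5.1, proof of Lemma 1 (p. 9), the operator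
`𝓕(O) = ∫ w_γ'(t) τ_t^{H_s}(O) dt` is built from "the filter function studied in [BMNS:2011,
hastings:2010], with the following properties: Compact Fourier Transform [I1934]:
`ŵ_γ'(ω) = 0` for `|ω| ≥ γ'` and `ŵ_γ'(0) = 1`. Rapid decay …"; only these two Fourier
properties and integrable (here: Schwartz, i.e. superpolynomial) decay are used in the proof.
The explicit near-exponentially decaying `w_γ` of BMNS 2011 (from Ingham 1934) is replaced here
by the inverse Fourier transform of a smooth bump function, which is a Schwartz function
(Mathlib: `HasCompactSupport.toSchwartzMap`, the Fourier pair on `𝓢(ℝ, ℂ)`); its decay is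
superpolynomial, which suffices for all superpolynomial estimates of MZ13. The function is
real-valued (the bump is even), so `𝓕` preserves adjoints.

Statement: `exists_schwartz_filter` — for `γ > 0` there is `w : 𝓢(ℝ, ℂ)` with `∫ w = 1`,
`∫ e^{itΔ} w(t) dt = 0` whenever `|Δ| ≥ γ`, and `conj (w t) = w t` for all `t`.
No definitions, no named facts (an existence theorem).
-/

noncomputable section

open MeasureTheory Real Complex SchwartzMap FourierTransform
open scoped FourierTransform

namespace Literature.MathematicalPhysics.QuantumLattice

/-- Fourier transform of a Schwartz function on `ℝ` in "physics" variables: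
`∫ e^{itΔ} f(t) dt = 𝓕 f (−Δ/(2π))` (Mathlib's `𝓕 f ξ = ∫ e^{−2πi t ξ} f t dt`). [folklore] -/
theorem integral_cexp_mul_eq_fourier (f : ℝ → ℂ) (Δ : ℝ) :
    ∫ t : ℝ, cexp (t * Δ * I) * f t = 𝓕 f (-Δ / (2 * π)) := by
  rw [Real.fourier_real_eq_integral_exp_smul]
  refine integral_congr_ae (Filter.Eventually.of_forall fun t => ?_)
  simp only [smul_eq_mul]
  congr 2
  push_cast
  field_simp

/-- **Existence of a spectral filter function.** For every `γ > 0` there is a Schwartz function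
`w : ℝ → ℂ` with `∫ w = 1`, `∫ e^{itΔ} w(t) dt = 0` for all `|Δ| ≥ γ` (its Fourier transform is a
smooth bump supported in `|ξ| < γ/(2π)` and equal to `1` near `0`), and real values
(`conj (w t) = w t`). These are the properties "ŵ_γ'(ω) = 0 for |ω| ≥ γ' and ŵ_γ'(0) = 1" of the
filter function used by Michalakis–Zwolak, §5.1, proof of Lemma 1 (arXiv:1109.1588 p. 9), after
Bachmann–Michalakis–Nachtergaele–Sims (2011) and Hastings (2010); the decay here is that of a
Schwartz function (superpolynomial) instead of the near-exponential decay of the BMNS filter.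
[cite: MichalakisZwolakCMP2013, §5.1 proof of Lemma 1 (arXiv:1109.1588 p. 9)] -/
theorem exists_schwartz_filter {γ : ℝ} (hγ : 0 < γ) :
    ∃ w : 𝓢(ℝ, ℂ), (∫ t : ℝ, w t) = 1 ∧
      (∀ Δ : ℝ, γ ≤ |Δ| → ∫ t : ℝ, cexp (t * Δ * I) * w t = 0) ∧
      (∀ t : ℝ, starRingEnd ℂ (w t) = w t) := by
  -- a smooth bump in Fourier space, supported in `|ξ| < γ/(2π)`, equal to `1` near `0`
  have h4 : 0 < γ / (4 * π) := by positivity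
  have hlt : γ / (4 * π) < γ / (2 * π) := by
    rw [div_lt_div_iff_of_pos_left hγ (by positivity) (by positivity)]
    linarith [pi_pos]
  let b : ContDiffBump (0 : ℝ) := ⟨γ / (4 * π), γ / (2 * π), h4, hlt⟩
  let φ : ℝ → ℂ := fun ξ => ((b ξ : ℝ) : ℂ)
  have hφs : HasCompactSupport φ := b.hasCompactSupport.comp_left Complex.ofReal_zero
  have hφd : ContDiff ℝ (⊤ : ℕ∞) φ := (Complex.ofRealCLM.contDiff.comp b.contDiff)
  set ψ : 𝓢(ℝ, ℂ) := hφs.toSchwartzMap hφd with hψ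
  have hψ_apply : ∀ ξ, ψ ξ = ((b ξ : ℝ) : ℂ) := fun ξ => rfl
  set w : 𝓢(ℝ, ℂ) := 𝓕⁻ ψ with hw
  have hFw : 𝓕 w = ψ := fourier_fourierInv_eq ψ
  have hFw' : ∀ ξ, 𝓕 (w : ℝ → ℂ) ξ = ((b ξ : ℝ) : ℂ) := fun ξ => by
    rw [← fourier_coe, hFw, hψ_apply]
  refine ⟨w, ?_, ?_, ?_⟩
  · -- `∫ w = 𝓕 w 0 = b 0 = 1`
    have h1 := integral_cexp_mul_eq_fourier (w : ℝ → ℂ) 0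
    simp only [Complex.ofReal_zero, mul_zero, zero_mul, Complex.exp_zero, one_mul, neg_zero,
      zero_div] at h1
    rw [h1, hFw', b.one_of_mem_closedBall (Metric.mem_closedBall_self h4.le), Complex.ofReal_one]
  · -- `∫ e^{itΔ} w = b(−Δ/2π) = 0` for `|Δ| ≥ γ`
    intro Δ hΔ
    rw [integral_cexp_mul_eq_fourier, hFw', b.zero_of_le_dist, Complex.ofReal_zero]
    show γ / (2 * π) ≤ dist (-Δ / (2 * π)) 0
    rw [Real.dist_eq, sub_zero, abs_div, abs_neg, abs_of_pos (by positivity : (0:ℝ) < 2 * π)]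
    exact div_le_div_of_nonneg_right hΔ (by positivity)
  · -- real values: `w = 𝓕⁻ φ` with `φ` real and even
    intro t
    have hwt : (w : ℝ → ℂ) t = ∫ v : ℝ, cexp (↑(2 * π * (v * t)) * I) * ((b v : ℝ) : ℂ) := by
      rw [show (w : ℝ → ℂ) t = 𝓕⁻ (ψ : ℝ → ℂ) t by rw [← fourierInv_coe]]
      rw [Real.fourierInv_eq']
      refine integral_congr_ae (Filter.Eventually.of_forall fun v => ?_)
      simp only [smul_eq_mul, hψ_apply, Real.inner_apply]
    change starRingEnd ℂ ((w : ℝ → ℂ) t) = (w : ℝ → ℂ) t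
    rw [hwt, ← integral_conj]
    -- conjugate the integrand and substitute `v ↦ -v`
    have hconj : (fun v : ℝ => (starRingEnd ℂ) (cexp (↑(2 * π * (v * t)) * I) * ((b v : ℝ) : ℂ))) =
        fun v : ℝ => cexp (↑(2 * π * ((-v) * t)) * I) * ((b (-v) : ℝ) : ℂ) := by
      funext v
      rw [map_mul, Complex.conj_ofReal, ← Complex.exp_conj, map_mul, Complex.conj_ofReal,
        Complex.conj_I, b.neg]
      congr 2
      push_cast
      ring
    rw [hconj]
    exact integral_neg_eq_self (fun v : ℝ => cexp (↑(2 * π * (v * t)) * I) * ((b v : ℝ) : ℂ))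
      volume

end Literature.MathematicalPhysics.QuantumLattice
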